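import Summits.KontsevichZagierPeriods.KontsevichZagierPeriods.Theorems.SoloBlindZetaBox
import Literature.NumberTheory.Transcendental.MultipleZetaDuality
import HarnessLib

/-!
# MZV duality is ONE Kontsevich–Zagier move

Hoffman's duality `ζ(s†) = ζ(s)` of multiple zeta values (the dual index `s†`: the binary word
of `s` read backwards with `0 ↔ 1`) is proved in the Literature
(`multipleZeta_duality`) as an equality of REAL NUMBERS, by the substitution
`uᵢ = 1 - t_{w-1-i}` in Kontsevich's iterated integral. The Kontsevich–Zagier period conjecture
then PREDICTS that the two simplex representations
`Λ_s = [Δ_w, ∏ᵢ ω_{εᵢ(s)}(tᵢ)]` and `Λ_{s†}` (the Literature's `KZ.mzvRep s`, `KZ.mzvRep s†`) are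
equivalent under the three rules. We VERIFY this prediction, uniformly for every dual pair of
admissible indices: the duality involution `τ(t)ᵢ = 1 - t_{w-1-i}` IS a single admissible move of
rule (2) — a `ℚ`-polynomial diffeomorphism of the open ordered simplex onto itself with
`|det Dτ| = 1` (`Dτ ∘ Dτ = id`), exchanging the two forms letter by letter.

Main results:

* `wordRep L w` — the simplex representation of an arbitrary binary word `L` at dimension `w`
  (rational: `isRational_wordRep`); `mzvSimplexRep s = KZ.mzvRep s` fed with the Literature's two
  analytic facts, and `mzvSimplexRep_eq_wordRep` (definitional);
* `exists_dualChart` — the chart data of `τ`; `equivalent_wordRep_dual` — ONE move between the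
  word representations of dual words (integrability transported along the chart, not assumed);
* `kz_mzv_duality : Equivalent (mzvSimplexRep s) (mzvSimplexRep s†)` for every dual pair — an
  infinite family of instances of the conjecture relating representations of DIFFERENT shape
  (e.g. depth `1` versus depth `n`);
* instances: `kz_zeta_three_two_one` (`Λ_(3) ≡ Λ_(2,1)`, Euler), Hoffman's family
  `kz_hoffman_duality` (`Λ_(n+2,{1}^m) ≡ Λ_(m+2,{1}^n)`), `kz_zeta_two_ones`; and, composed with
  the box/simplex move of `SoloBlindZetaBox`, **Beukers' box for `ζ(n+2)` ≡ Kontsevich's simplex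
  for `ζ(2,{1}^n)` in TWO moves** (`kz_box_zeta_two_ones`; `n = 1`: `B_3 ≡ Λ_(2,1)`);
* the values agree move-theoretically (`multipleZeta_eq_of_dual_move`), recovering
  `multipleZeta_duality` through `relations ≤ ker eval`.

References: M. E. Hoffman, *Multiple harmonic series*, Pacific J. Math. 152 (1992), §3–4;
D. Zagier, *Values of zeta functions and their applications* (1994), §9; M. Kontsevich,
D. Zagier, *Periods* (2001), §1.1–1.2.
-/

noncomputable section

namespace Summit.KontsevichZagierPeriods.KontsevichZagierPeriods.Theorems

open Set MeasureTheory
open Literature.ModelTheory.ExponentialFields (IsSemialgebraic isSemialgebraic_setOf_eval_pos)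
open MvPolynomial (aeval X)
open Literature.NumberTheory.Transcendental
open Literature.NumberTheory.Transcendental.KZ

namespace SoloBlind

variable {w : ℕ}

/-! ## Word integrands and word representations -/

/-- `∏ᵢ ω_{Lᵢ}(tᵢ)` for an arbitrary binary word `L` (junk letter `0` beyond its length), at
dimension `w`. -/
def wordIntegrand (L : List Bool) (w : ℕ) (t : Fin w → ℝ) : ℝ :=
  ∏ i : Fin w, mzvForm (L.getD i false) (t i)

/-- Kontsevich's integrand is the word integrand of the binary word of the index. -/
theorem mzvIntegrand_eq_wordIntegrand (s : List ℕ) :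
    mzvIntegrand s = wordIntegrand (MZV.binaryWord s) (MZV.weight s) := rfl

/-- The denominator polynomial `∏ᵢ (1 - Xᵢ or Xᵢ)` of a word integrand. -/
def wordDen (L : List Bool) (w : ℕ) : MvPolynomial (Fin w) ℚ :=
  ∏ i : Fin w, if L.getD i false then 1 - X i else X i

/-- The two forms as reciprocals. -/
theorem mzvForm_eq_one_div (b : Bool) (x : ℝ) :
    mzvForm b x = 1 / (if b then 1 - x else x) := by
  cases b <;> simp [mzvForm]

/-- Evaluation of the denominator polynomial. -/
theorem aeval_wordDen (L : List Bool) (w : ℕ) (t : Fin w → ℝ) :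
    aeval t (wordDen L w) = ∏ i : Fin w, (if L.getD i false then 1 - t i else t i) := by
  simp only [wordDen, map_prod]
  refine Finset.prod_congr rfl fun i _ => ?_
  split_ifs <;> simp

/-- The denominator does not vanish on the open ordered simplex. -/
theorem aeval_wordDen_ne_zero (L : List Bool) {t : Fin w → ℝ} (ht : t ∈ openOrderedSimplex w) :
    aeval t (wordDen L w) ≠ 0 := by
  rw [aeval_wordDen]
  refine Finset.prod_ne_zero_iff.mpr fun i _ => ?_
  split_ifs
  · exact (sub_pos.2 (ht.2.1 i)).ne'
  · exact (ht.1 i).ne'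

/-- A word integrand is the rational function `1 / wordDen`. -/
theorem wordIntegrand_eq_aeval_div (L : List Bool) (w : ℕ) (t : Fin w → ℝ) :
    wordIntegrand L w t =
      aeval t (1 : MvPolynomial (Fin w) ℚ) / aeval t (wordDen L w) := by
  rw [map_one, aeval_wordDen, wordIntegrand, one_div, ← Finset.prod_inv_distrib]
  exact Finset.prod_congr rfl fun i _ => by rw [mzvForm_eq_one_div, one_div]

/-- Word integrands are `ℚ`-semialgebraic functions on the simplex. -/
theorem isSemialgebraicFunOn_wordIntegrand (L : List Bool) (w : ℕ) :
    IsSemialgebraicFunOn ℚ (openOrderedSimplex w) (wordIntegrand L w) :=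
  (isSemialgebraicFunOn_aeval_div_aeval (isSemialgebraic_openOrderedSimplex w) 1 (wordDen L w)
    fun _ ht => aeval_wordDen_ne_zero L ht).congr fun t _ => by
      rw [wordIntegrand_eq_aeval_div]

/-- **The word representation** `[Δ_w, ∏ᵢ ω_{Lᵢ}(tᵢ)]` of a binary word at dimension `w`, given
absolute convergence. -/
def wordRep (L : List Bool) (w : ℕ)
    (hint : IntegrableOn (wordIntegrand L w) (openOrderedSimplex w)) : IntegralRep w where
  domain := openOrderedSimplex w
  integrand := wordIntegrand L w
  isSemialgebraic_domain := isSemialgebraic_openOrderedSimplex w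
  isSemialgebraicFunOn_integrand := isSemialgebraicFunOn_wordIntegrand L w
  integrableOn := hint

/-- Data of a word representation. -/
@[simp] theorem wordRep_domain (L : List Bool) (w : ℕ) (hint) :
    (wordRep L w hint).domain = openOrderedSimplex w := rfl

/-- Data of a word representation. -/
@[simp] theorem wordRep_integrand (L : List Bool) (w : ℕ) (hint) :
    (wordRep L w hint).integrand = wordIntegrand L w := rfl

/-- Word representations are rational. -/
theorem isRational_wordRep (L : List Bool) (w : ℕ) (hint) : (wordRep L w hint).IsRational :=
  ⟨1, wordDen L w, fun _ ht => aeval_wordDen_ne_zero L ht,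
    fun t _ => wordIntegrand_eq_aeval_div L w t⟩

/-- Changing the dimension along an equality costs no move. -/
theorem wordRep_cast (L : List Bool) {w w' : ℕ} (h : w' = w) (hint') (hint) :
    Equivalent (wordRep L w' hint') (wordRep L w hint) := by
  subst h
  exact Equivalent.refl _

/-- **Kontsevich's simplex representation** `Λ_s` of `ζ(s)`: the Literature's `KZ.mzvRep s`, fed
with its two proved analytic facts. -/
def mzvSimplexRep (s : List ℕ) (hs : MZV.IsAdmissible s) : IntegralRep (MZV.weight s) :=
  mzvRep s hs (mzvIntegrand_isSemialgebraicFunOn_holds s) (mzvIntegrand_integrableOn_holds s hs)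

/-- `Λ_s` is the word representation of the binary word of `s` (definitionally). -/
theorem mzvSimplexRep_eq_wordRep (s : List ℕ) (hs : MZV.IsAdmissible s) :
    mzvSimplexRep s hs =
      wordRep (MZV.binaryWord s) (MZV.weight s) (mzvIntegrand_integrableOn_holds s hs) := rfl

/-- The `ζ(n)` simplex of `SoloBlindZetaBox` is `Λ_(n)`. -/
theorem simplexZetaRep_eq (n : ℕ) (hn : 2 ≤ n) :
    simplexZetaRep n hn = mzvSimplexRep [n] (isAdmissible_singleton hn) := rfl

/-- `Λ_s` is rational. -/
theorem isRational_mzvSimplexRep (s : List ℕ) (hs : MZV.IsAdmissible s) :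
    (mzvSimplexRep s hs).IsRational :=
  isRational_wordRep _ _ _

/-- `value Λ_s = ζ(s)` (Kontsevich's formula, from the Literature). -/
theorem mzvSimplexRep_value (s : List ℕ) (hs : MZV.IsAdmissible s) :
    (mzvSimplexRep s hs).value = multipleZeta s :=
  mzvRep_value_holds s hs _ _

/-! ## The duality chart `τ(t)ᵢ = 1 - t_{w-1-i}` -/

/-- The duality involution of `ℝ^w`. -/
def dualChart (w : ℕ) (t : Fin w → ℝ) : Fin w → ℝ := fun i => 1 - t (Fin.rev i)

/-- Its (constant) derivative `v ↦ (-v_{w-1-i})ᵢ`. -/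
def dualChartDeriv (w : ℕ) : (Fin w → ℝ) →L[ℝ] (Fin w → ℝ) :=
  ContinuousLinearMap.pi fun i : Fin w =>
    -ContinuousLinearMap.proj (R := ℝ) (φ := fun _ : Fin w => ℝ) (Fin.rev i)

/-- Coordinates of the duality chart. -/
@[simp] theorem dualChart_apply (t : Fin w → ℝ) (i : Fin w) :
    dualChart w t i = 1 - t (Fin.rev i) := rfl

/-- Coordinates of its derivative. -/
@[simp] theorem dualChartDeriv_apply (v : Fin w → ℝ) (i : Fin w) :
    dualChartDeriv w v i = -v (Fin.rev i) := by
  simp [dualChartDeriv]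

/-- The duality chart is an involution. -/
theorem dualChart_dualChart (t : Fin w → ℝ) : dualChart w (dualChart w t) = t := by
  funext i
  simp [Fin.rev_rev]

/-- The duality chart is differentiable with the stated derivative. -/
theorem hasFDerivAt_dualChart (t : Fin w → ℝ) : HasFDerivAt (dualChart w) (dualChartDeriv w) t := by
  unfold dualChart dualChartDeriv
  rw [hasFDerivAt_pi]
  intro i
  exact (hasFDerivAt_apply (Fin.rev i) t).const_sub 1

/-- `Dτ ∘ Dτ = id`. -/
theorem dualChartDeriv_comp :
    (dualChartDeriv w : (Fin w → ℝ) →ₗ[ℝ] (Fin w → ℝ)).comp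
        (dualChartDeriv w : (Fin w → ℝ) →ₗ[ℝ] (Fin w → ℝ)) = LinearMap.id := by
  apply LinearMap.ext
  intro v
  funext i
  simp [Fin.rev_rev]

/-- `|det Dτ| = 1` (from `Dτ ∘ Dτ = id`, no matrices). -/
theorem abs_det_dualChartDeriv : |(dualChartDeriv w).det| = 1 := by
  have h1 := congrArg LinearMap.det (dualChartDeriv_comp (w := w))
  rw [LinearMap.det_comp, LinearMap.det_id] at h1
  show |LinearMap.det (dualChartDeriv w : (Fin w → ℝ) →ₗ[ℝ] (Fin w → ℝ))| = 1
  rcases mul_self_eq_one_iff.mp h1 with h | h <;> simp [h]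

/-- **The duality chart.** `τ` is a `ℚ`-semialgebraic (polynomial) diffeomorphism of the open
ordered simplex ONTO itself with `|det Dτ| = 1`. -/
theorem exists_dualChart (w : ℕ) :
    IsSemialgebraicMapOn ℚ (openOrderedSimplex w) (dualChart w) ∧
      (∀ t ∈ openOrderedSimplex w, HasFDerivAt (dualChart w) (dualChartDeriv w) t) ∧
      InjOn (dualChart w) (openOrderedSimplex w) ∧
      dualChart w '' openOrderedSimplex w = openOrderedSimplex w ∧
      ∀ t ∈ openOrderedSimplex w, |(dualChartDeriv w).det| = (fun _ => (1 : ℝ)) t := by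
  refine ⟨?_, fun t _ => hasFDerivAt_dualChart t, ?_, ?_, fun t _ => abs_det_dualChartDeriv⟩
  · convert isSemialgebraicMapOn_aeval (isSemialgebraic_openOrderedSimplex w)
      (fun i : Fin w => (1 - X (Fin.rev i) : MvPolynomial (Fin w) ℚ)) using 2 with t
    funext i
    simp
  · intro x _ y _ hxy
    have h := congrArg (dualChart w) hxy
    rwa [dualChart_dualChart, dualChart_dualChart] at h
  · refine Subset.antisymm (image_subset_iff.mpr fun t ht => mem_openOrderedSimplex_dual ht)
      fun t ht => ⟨dualChart w t, mem_openOrderedSimplex_dual ht, dualChart_dualChart t⟩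

/-! ## Dual words: one move -/

/-- The pull-back identity: for dual words, `∏ ω_{Lᵢ}(tᵢ) = (∏ ω_{L'ᵢ}) (τ t) · |det Dτ|`. -/
theorem wordIntegrand_dual {L L' : List Bool}
    (h : ∀ i : Fin w, L'.getD i false = !L.getD (Fin.rev i) false) (t : Fin w → ℝ) :
    wordIntegrand L w t = wordIntegrand L' w (dualChart w t) * 1 := by
  rw [mul_one]
  unfold wordIntegrand
  simp only [dualChart_apply, h, mzvForm_not_one_sub]
  exact (Equiv.prod_comp Fin.revPerm (fun i => mzvForm (L.getD i false) (t i))).symm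

/-- Absolute convergence is transported along the duality chart. -/
theorem integrableOn_wordIntegrand_dual {L L' : List Bool}
    (h : ∀ i : Fin w, L'.getD i false = !L.getD (Fin.rev i) false)
    (hint : IntegrableOn (wordIntegrand L w) (openOrderedSimplex w)) :
    IntegrableOn (wordIntegrand L' w) (openOrderedSimplex w) := by
  obtain ⟨-, hderiv, hinj, himage, hdet⟩ := exists_dualChart w
  have key := (integrableOn_iff_of_chart (measurableSet_openOrderedSimplex w) hderiv hinj hdet
    (fun t _ => wordIntegrand_dual h t)).mpr hint
  rwa [himage] at key

/-- **One move between dual words**: `[Δ, ∏ ω_{Lᵢ}] ≡ [Δ, ∏ ω_{L'ᵢ}]` by the change of variables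
`τ` whenever `L'` is `L` read backwards with the letters exchanged. -/
theorem equivalent_wordRep_dual {L L' : List Bool}
    (h : ∀ i : Fin w, L'.getD i false = !L.getD (Fin.rev i) false) (hint) (hint') :
    Equivalent (wordRep L w hint) (wordRep L' w hint') := by
  obtain ⟨hsa, hderiv, hinj, himage, hdet⟩ := exists_dualChart w
  exact equivalent_of_chart hsa hderiv hinj himage hdet (f := wordIntegrand L w)
    (g := wordIntegrand L' w) (fun t _ => wordIntegrand_dual h t) rfl (fun _ _ => rfl) rfl
    (fun _ _ => rfl)

/-! ## MZV duality inside the rules -/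

/-- **MZV duality is one Kontsevich–Zagier move.** If the binary word of the admissible index `s'`
is that of `s` read backwards with `0 ↔ 1` (`s' = s†`), then Kontsevich's simplex
representations of `ζ(s)` and `ζ(s')` are KZ-equivalent — by ONE change of variables. -/
theorem kz_mzv_duality {s s' : List ℕ} (hs : MZV.IsAdmissible s) (hs' : MZV.IsAdmissible s')
    (h : MZV.binaryWord s' = (MZV.binaryWord s).reverse.map fun b => !b) :
    Equivalent (mzvSimplexRep s hs) (mzvSimplexRep s' hs') := by
  have hw : MZV.weight s' = MZV.weight s := MZV.weight_eq_of_binaryWord_eq_dual hs hs' h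
  have hε : ∀ i : Fin (MZV.weight s),
      (MZV.binaryWord s').getD i false = !(MZV.binaryWord s).getD (Fin.rev i) false := by
    intro i
    rw [h]
    exact getD_reverse_map_not hs.length_binaryWord i
  have hint' : IntegrableOn (wordIntegrand (MZV.binaryWord s') (MZV.weight s))
      (openOrderedSimplex (MZV.weight s)) :=
    integrableOn_wordIntegrand_dual hε (mzvIntegrand_integrableOn_holds s hs)
  rw [mzvSimplexRep_eq_wordRep, mzvSimplexRep_eq_wordRep]
  exact (equivalent_wordRep_dual hε _ hint').trans (wordRep_cast _ hw _ _).symm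

/-- The values agree through the move: `ζ(s) = ζ(s†)` recovered from `relations ≤ ker eval`
(in agreement with the Literature's `multipleZeta_duality`). -/
theorem multipleZeta_eq_of_dual_move {s s' : List ℕ} (hs : MZV.IsAdmissible s)
    (hs' : MZV.IsAdmissible s')
    (h : MZV.binaryWord s' = (MZV.binaryWord s).reverse.map fun b => !b) :
    multipleZeta s = multipleZeta s' := by
  have hk := relations_le_ker_eval_holds (kz_mzv_duality hs hs' h)
  rw [AddMonoidHom.mem_ker, map_sub, eval_of, eval_of, sub_eq_zero, mzvSimplexRep_value,
    mzvSimplexRep_value] at hk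
  exact hk

/-! ## Instances -/

/-- `[2,1]` is admissible. -/
theorem isAdmissible_two_one : MZV.IsAdmissible [2, 1] :=
  MZV.isAdmissible_add_two_cons_replicate_one 0 1

/-- **Euler's `ζ(2,1) = ζ(3)` inside the rules**: `Λ_(3) = [Δ₃, dt/(t₀t₁(1-t₂))]` and
`Λ_(2,1) = [Δ₃, dt/(t₀(1-t₁)(1-t₂))]` are KZ-equivalent by one move. -/
theorem kz_zeta_three_two_one :
    Equivalent (mzvSimplexRep [3] (isAdmissible_singleton (by norm_num)))
      (mzvSimplexRep [2, 1] isAdmissible_two_one) :=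
  kz_mzv_duality _ _ (by decide)

/-- **Hoffman's family inside the rules**: `Λ_(n+2,{1}^m) ≡ Λ_(m+2,{1}^n)` by one move. -/
theorem kz_hoffman_duality (m n : ℕ) :
    Equivalent
      (mzvSimplexRep ((n + 2) :: List.replicate m 1)
        (MZV.isAdmissible_add_two_cons_replicate_one n m))
      (mzvSimplexRep ((m + 2) :: List.replicate n 1)
        (MZV.isAdmissible_add_two_cons_replicate_one m n)) := by
  refine kz_mzv_duality _ _ ?_
  rw [MZV.binaryWord_add_two_cons_replicate_one, MZV.binaryWord_add_two_cons_replicate_one,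
    List.reverse_append, List.reverse_replicate, List.reverse_replicate, List.map_append,
    List.map_replicate, List.map_replicate]
  rfl

/-- `ζ(n+2)`'s simplex versus `ζ(2,{1}^n)`'s simplex: one move (`n = 1` is Euler's pair). -/
theorem kz_zeta_two_ones (n : ℕ) :
    Equivalent (mzvSimplexRep [n + 2] (isAdmissible_singleton (by omega)))
      (mzvSimplexRep (2 :: List.replicate n 1)
        (MZV.isAdmissible_add_two_cons_replicate_one 0 n)) :=
  kz_hoffman_duality 0 n

/-- **Beukers' box for `ζ(n+2)` ≡ Kontsevich's simplex for `ζ(2,{1}^n)`, in TWO moves**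
(`SoloBlindZetaBox.kz_zeta_box_simplex`, then duality). -/
theorem kz_box_zeta_two_ones (n : ℕ) :
    Equivalent (boxZetaRep (n + 2) (by omega))
      (mzvSimplexRep (2 :: List.replicate n 1)
        (MZV.isAdmissible_add_two_cons_replicate_one 0 n)) :=
  (kz_zeta_box_simplex (n := n + 2) (by omega)).trans (kz_zeta_two_ones n)

/-- In particular `B_3 = [(0,1)³, dx/(1-x₀x₁x₂)] ≡ Λ_(2,1) = [Δ₃, dt/(t₀(1-t₁)(1-t₂))]`:
Euler's identity `ζ(3) = ζ(2,1)` as a two-move KZ-equivalence between a box and a simplex. -/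
theorem kz_box_zeta_three_two_one :
    Equivalent (boxZetaRep 3 (by norm_num)) (mzvSimplexRep [2, 1] isAdmissible_two_one) :=
  kz_box_zeta_two_ones 1

/-- And the numbers: `∫_{(0,1)³} dx/(1-x₀x₁x₂) = ζ(2,1)`, through the two moves. -/
theorem box_three_value_eq_zeta_two_one :
    (boxZetaRep 3 (by norm_num)).value = multipleZeta [2, 1] := by
  have hk := relations_le_ker_eval_holds kz_box_zeta_three_two_one
  rw [AddMonoidHom.mem_ker, map_sub, eval_of, eval_of, sub_eq_zero, mzvSimplexRep_value] at hk
  exact hk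

end SoloBlind

end Summit.KontsevichZagierPeriods.KontsevichZagierPeriods.Theorems
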